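import Summits.Ventures.Crystal3D.Bulk.LocalTwelve
import Summits.Ventures.Crystal3D.StickySpheres.RadiusOne
import HarnessLib

/-!
# Non-vacuity of the close-packed shell predicate: the centre of the fcc nucleus

HONEST FRAMING. Part of the venture `Summits/Ventures/Crystal3D` (cell `pub-crystal3d`, phase 2),
companion of `Bulk/LocalTwelve.lean`. A red-team / sanity file: the predicate
`IsClosePackedShell` of the phase-2 statement `BulkCrystallization3D` is SATISFIABLE and means
what it should — the centre ball of the `13`-ball fcc nucleus (centred cuboctahedron, the tree's
integer model `fccNucleusInt 0` at contact distance `1`, a sticky ground state candidate with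
`36 = C(13)` contacts) has a close-packed shell, its contact shell being literally the doubled FCC
pattern `2 · fccKissingPattern`; hence that packing has at most `12 < 13` non-close-packed balls.
Kernel arithmetic on the integer model only; nothing is claimed beyond this example.
-/

noncomputable section

open scoped BigOperators
open Finset

namespace Summit.Ventures.Crystal3D

open Literature.Geometry.DiscreteGeometry (fccKissingPattern fccInt intVec sqNormInt scaledPattern
  isArrangedIn_self)
open Literature.Barriers.AtomisticToContinuum (intConfig fccNucleusInt sep_fccNucleus
  intContactNumber_fccNucleus)

variable {N : ℕ}

/-! ## Contact neighbours in integer models -/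

/-- In an integer model at scale `1/√m` the contact neighbours of `i` are the labels `j ≠ i` at
integer squared distance exactly `m` (kernel arithmetic). -/
theorem mem_contactNeighbors_intConfig (c : Fin N → Fin 3 → ℤ) {m : ℕ} (hm : 0 < m)
    {i j : Fin N} :
    j ∈ contactNeighbors (intConfig c (1 / Real.sqrt m)) i ↔
      j ≠ i ∧ sqNormInt (c i - c j) = m := by
  have hmR : (0 : ℝ) < m := by exact_mod_cast hm
  rw [mem_contactNeighbors, dist_intConfig_inv_sqrt c hm, Real.sqrt_eq_one,
    div_eq_one_iff_eq hmR.ne']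
  norm_cast

/-! ## The fcc nucleus of thirteen balls -/

/-! The `13`-ball fcc nucleus at contact distance `1` — centre `0` and the twelve cuboctahedron
vertices `(±1, ±1, 0)/√2, …` — is the tree's integer model `fccNucleusInt 0` at scale `1/√2`,
written `intConfig (fccNucleusInt 0) (1 / Real.sqrt (2 : ℕ))` throughout (no new definition). -/

/-- The fcc nucleus is a packing of unit-diameter balls. -/
theorem isUnitPacking_fccNucleus_thirteen :
    IsUnitPacking (intConfig (fccNucleusInt 0) (1 / Real.sqrt (2 : ℕ))) :=
  isUnitPacking_intConfig _ (by norm_num) (sep_fccNucleus 0)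

/-- It has `36` contacts (`12` radial + `24` cuboctahedral). -/
theorem numContacts_fccNucleus_thirteen :
    numContacts (intConfig (fccNucleusInt 0) (1 / Real.sqrt (2 : ℕ))) = 36 := by
  rw [numContacts_intConfig _ (by norm_num)]
  exact_mod_cast intContactNumber_fccNucleus 0

/-- Every non-central label is at squared distance `2` from the centre (integer arithmetic). -/
theorem sqNormInt_fccNucleus_centre :
    ∀ j : Fin 13, j ≠ 0 → sqNormInt (fccNucleusInt 0 0 - fccNucleusInt 0 j) = (2 : ℕ) := by
  decide +kernel

/-- The non-central labels of the model are exactly the twelve fcc minimal vectors `fccInt`. -/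
theorem image_fccNucleusInt_erase_zero :
    (univ.erase (0 : Fin 13)).image (fccNucleusInt 0) = fccInt := by
  decide +kernel

/-- The centre of the model is the origin. -/
theorem fccNucleus_centre_eq_zero :
    intConfig (fccNucleusInt 0) (1 / Real.sqrt (2 : ℕ)) 0 = 0 := by
  have h : fccNucleusInt 0 0 = 0 := by decide +kernel
  ext k
  simp [intConfig, h, intVec]

/-- The contact neighbours of the centre are all twelve other balls. -/
theorem contactNeighbors_fccNucleus_centre :
    contactNeighbors (intConfig (fccNucleusInt 0) (1 / Real.sqrt (2 : ℕ))) 0 = univ.erase 0 := by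
  ext j
  rw [mem_contactNeighbors_intConfig _ (by norm_num), mem_erase]
  constructor
  · rintro ⟨hj, -⟩; exact ⟨hj, mem_univ _⟩
  · rintro ⟨hj, -⟩; exact ⟨hj, sqNormInt_fccNucleus_centre j hj⟩

/-- The centre ball has twelve contacts. -/
theorem coordination_fccNucleus_centre :
    coordination (intConfig (fccNucleusInt 0) (1 / Real.sqrt (2 : ℕ))) 0 = 12 := by
  rw [coordination, contactNeighbors_fccNucleus_centre, card_erase_of_mem (mem_univ _)]
  simp

/-- **The contact shell of the centre is the doubled FCC pattern** `2 · fccKissingPattern`. -/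
theorem contactShell_fccNucleus_centre :
    contactShell (intConfig (fccNucleusInt 0) (1 / Real.sqrt (2 : ℕ))) 0 =
      (fun p => (2 : ℝ) • p) '' (fccKissingPattern : Set (EuclideanSpace ℝ (Fin 3))) := by
  rw [contactShell, contactNeighbors_fccNucleus_centre, fccNucleus_centre_eq_zero,
    fccKissingPattern, scaledPattern, ← image_fccNucleusInt_erase_zero, coe_image, coe_image,
    Set.image_image, Set.image_image]
  refine Set.image_congr' fun j => ?_
  simp only [sub_zero, intConfig, one_div, smul_smul]

/-- **Non-vacuity of `IsClosePackedShell`**: the centre of the fcc nucleus has a close-packed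
(FCC) first shell. -/
theorem isClosePackedShell_fccNucleus_centre :
    IsClosePackedShell (intConfig (fccNucleusInt 0) (1 / Real.sqrt (2 : ℕ))) 0 := by
  left
  rw [contactShell_fccNucleus_centre]
  exact isArrangedIn_self fccKissingPattern

/-- Hence the fcc nucleus has at most `12` (of `13`) non-close-packed balls: the defect count of
`BulkCrystallization3D` is not trivially everything. -/
theorem card_nonClosePacked_fccNucleus_le :
    (nonClosePacked (intConfig (fccNucleusInt 0) (1 / Real.sqrt (2 : ℕ)))).card ≤ 12 := by
  have h : nonClosePacked (intConfig (fccNucleusInt 0) (1 / Real.sqrt (2 : ℕ))) ⊆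
      univ.erase 0 := by
    intro i hi
    rw [mem_erase]
    refine ⟨?_, mem_univ _⟩
    rintro rfl
    exact (mem_nonClosePacked.1 hi) isClosePackedShell_fccNucleus_centre
  calc (nonClosePacked (intConfig (fccNucleusInt 0) (1 / Real.sqrt (2 : ℕ)))).card
      ≤ (univ.erase (0 : Fin 13)).card := card_le_card h
    _ = 12 := by rw [card_erase_of_mem (mem_univ _)]; simp

end Summit.Ventures.Crystal3D

end
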